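import Mathlib.MeasureTheory.Integral.Bochner.Set
import Mathlib.MeasureTheory.Measure.Haar.OfBasis
import Mathlib.MeasureTheory.Group.Measure
import Mathlib.Analysis.SpecialFunctions.Trigonometric.Basic
import HarnessLib

/-!
# Unfolding `ℝ^k` into the `2πℤ^k`-translates of the box `[-π, π)^k`

Support file for the duality transformation of compact abelian lattice models (proof programme
of the named fact
`Literature.MathematicalPhysics.QuantumFieldTheory.FrohlichSpencerU1PerimeterLawD4` and of its
corollary `Literature.Barriers.QuantumFields.AbelianDeconfinementD4`). In the Villain model
(FS82 (2.2)–(2.3)) every link carries a compact angle `θ ∈ [-π, π)` and every plaquette an integer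
`n_p`; summing over the pure-gauge part `n = dℓ`, `ℓ ∈ ℤ^{links}`, of the integers is the same as
unfolding the angles to real variables `φ = θ + 2πℓ ∈ ℝ` ("transformation to the non-compact, dual
model", FS82 §2.1 (i); the Banks–Myerson–Kogut / Guth route), which is how the Gaussian
(spin-wave) integral over `ℝ^{links}` arises without the Poisson summation formula.

We prove the measure-theoretic identity behind this: the boxes
`B_ℓ = ∏ᵢ [-π + 2πℓᵢ, π + 2πℓᵢ)`, `ℓ ∈ ℤ^k`, partition `ℝ^k` (`boxOf`, `mem_transBox_iff`,
`iUnion_transBox`, `pairwise_disjoint_transBox`), and for every integrable `F : ℝ^k → E`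

* `integral_eq_tsum_setIntegral_transBox : ∫ F = ∑'_ℓ ∫_{B_ℓ} F`,
* `setIntegral_transBox : ∫_{B_ℓ} F = ∫_{B_0} F(θ + 2πℓ) dθ` (translation invariance),
* `integral_eq_tsum_setIntegral_box_add : ∫_{ℝ^k} F = ∑'_{ℓ ∈ ℤ^k} ∫_{[-π,π)^k} F(θ + 2πℓ) dθ`.

Everything is proved; no named fact is introduced.

## References

* J. Fröhlich, T. Spencer, Comm. Math. Phys. 83 (1982) 411–454, §2.1 (i), §2.2 (2.2)–(2.3).
  [FrohlichSpencerCMP1982]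
-/

noncomputable section

open MeasureTheory Set Real

namespace Literature.Probability.LatticeModels

namespace PeriodicUnfolding

variable {k : Type*} [Fintype k]

/-- The translate `2πℓ ∈ ℝ^k` of the integer vector `ℓ`. [folklore] -/
def shift (ℓ : k → ℤ) : k → ℝ := fun i => 2 * π * ℓ i

/-- The box `B_ℓ = ∏ᵢ [-π + 2πℓᵢ, π + 2πℓᵢ)`. [folklore] -/
def transBox (ℓ : k → ℤ) : Set (k → ℝ) :=
  Set.pi univ fun i => Ico (-π + 2 * π * ℓ i) (π + 2 * π * ℓ i)

/-- The index of the box containing `x`: `ℓᵢ = ⌊(xᵢ + π)/(2π)⌋`. [folklore] -/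
def boxOf (x : k → ℝ) : k → ℤ := fun i => ⌊(x i + π) / (2 * π)⌋

/-- One coordinate: `t ∈ [-π + 2πm, π + 2πm)` iff `m = ⌊(t + π)/(2π)⌋`. [folklore] -/
theorem mem_Ico_iff_eq_floor (t : ℝ) (m : ℤ) :
    t ∈ Ico (-π + 2 * π * m) (π + 2 * π * m) ↔ m = ⌊(t + π) / (2 * π)⌋ := by
  have h2π : 0 < 2 * π := by positivity
  rw [eq_comm, Int.floor_eq_iff, mem_Ico, le_div_iff₀ h2π, div_lt_iff₀ h2π]
  constructor <;> intro h <;> constructor <;> nlinarith [h.1, h.2]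

omit [Fintype k] in
/-- Membership in a box is membership coordinatewise. [folklore] -/
theorem mem_transBox_iff (x : k → ℝ) (ℓ : k → ℤ) : x ∈ transBox ℓ ↔ ℓ = boxOf x := by
  simp only [transBox, mem_pi, mem_univ, forall_true_left, funext_iff, boxOf]
  exact forall_congr' fun i => mem_Ico_iff_eq_floor (x i) (ℓ i)

omit [Fintype k] in
/-- The boxes cover `ℝ^k`. [folklore] -/
theorem iUnion_transBox : (⋃ ℓ : k → ℤ, transBox ℓ) = univ :=
  eq_univ_of_forall fun x => mem_iUnion.2 ⟨boxOf x, (mem_transBox_iff x _).2 rfl⟩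

omit [Fintype k] in
/-- The boxes are pairwise disjoint. [folklore] -/
theorem pairwise_disjoint_transBox :
    Pairwise (Function.onFun Disjoint (transBox : (k → ℤ) → Set (k → ℝ))) := by
  intro ℓ ℓ' hne
  refine Set.disjoint_left.2 fun x hx hx' => hne ?_
  rw [mem_transBox_iff] at hx hx'
  rw [hx, hx']

/-- The boxes are measurable. [folklore] -/
theorem measurableSet_transBox (ℓ : k → ℤ) : MeasurableSet (transBox ℓ : Set (k → ℝ)) :=
  MeasurableSet.univ_pi fun _ => measurableSet_Ico

omit [Fintype k] in
/-- `B_ℓ` is the translate of `B_0` by `2πℓ`: `(· + 2πℓ)⁻¹' B_ℓ = B_0`. [folklore] -/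
theorem preimage_add_shift_transBox (ℓ : k → ℤ) :
    (fun θ : k → ℝ => θ + shift ℓ) ⁻¹' transBox ℓ = transBox 0 := by
  ext θ
  simp only [mem_preimage, transBox, mem_pi, mem_univ, forall_true_left, Pi.add_apply, shift,
    Pi.zero_apply, Int.cast_zero, mul_zero, add_zero, mem_Ico]
  refine forall_congr' fun i => ?_
  constructor <;> intro h <;> constructor <;> linarith [h.1, h.2]

variable {E : Type*} [NormedAddCommGroup E] [NormedSpace ℝ E]

/-- **`∫_{ℝ^k} F = ∑'_ℓ ∫_{B_ℓ} F`** for integrable `F`. [folklore] -/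
theorem integral_eq_tsum_setIntegral_transBox (F : (k → ℝ) → E) (hF : Integrable F) :
    ∫ x, F x = ∑' ℓ : k → ℤ, ∫ x in transBox ℓ, F x := by
  rw [← integral_iUnion (fun ℓ => measurableSet_transBox ℓ) pairwise_disjoint_transBox
    (by rw [iUnion_transBox]; exact hF.integrableOn), iUnion_transBox, Measure.restrict_univ]

/-- **Translation invariance**: `∫_{B_ℓ} F = ∫_{B_0} F(θ + 2πℓ) dθ`. [folklore] -/
theorem setIntegral_transBox (F : (k → ℝ) → E) (ℓ : k → ℤ) :
    ∫ x in transBox ℓ, F x = ∫ θ in transBox 0, F (θ + shift ℓ) := by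
  have h := (measurePreserving_add_right (volume : Measure (k → ℝ)) (shift ℓ)).setIntegral_preimage_emb
    (measurableEmbedding_addRight (shift ℓ)) F (transBox ℓ)
  rw [preimage_add_shift_transBox] at h
  exact h.symm

/-- **Unfolding `ℝ^k`**: for integrable `F`,
`∫_{ℝ^k} F = ∑'_{ℓ ∈ ℤ^k} ∫_{[-π,π)^k} F(θ + 2πℓ) dθ` — summing over the pure-gauge integers of the
Villain model is unfolding the compact angles to real variables (FS82 §2.1 (i)).
[cite: FrohlichSpencerCMP1982, §2.1 (i), §2.2 (2.2)–(2.3) p. 418] -/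
theorem integral_eq_tsum_setIntegral_box_add (F : (k → ℝ) → E) (hF : Integrable F) :
    ∫ x, F x = ∑' ℓ : k → ℤ, ∫ θ in Set.pi univ (fun _ : k => Ico (-π) π), F (θ + shift ℓ) := by
  rw [integral_eq_tsum_setIntegral_transBox F hF]
  refine tsum_congr fun ℓ => ?_
  rw [setIntegral_transBox]
  congr 1
  simp [transBox]

omit [Fintype k] in
/-- The box `[-π,π)^k` is `B_0`. [folklore] -/
theorem pi_Ico_eq_transBox_zero : (Set.pi univ fun _ : k => Ico (-π) π) = transBox (0 : k → ℤ) := by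
  simp [transBox]

/-- The summands are absolutely summable (the boxes are disjoint): `∑_ℓ ‖∫_{B_0} F(· + 2πℓ)‖ ≤ ∫ ‖F‖`.
[folklore] -/
theorem summable_norm_setIntegral_box_add (F : (k → ℝ) → E) (hF : Integrable F) :
    Summable fun ℓ : k → ℤ => ‖∫ θ in Set.pi univ (fun _ : k => Ico (-π) π), F (θ + shift ℓ)‖ := by
  have hn : HasSum (fun ℓ : k → ℤ => ∫ x in transBox ℓ, ‖F x‖) (∫ x in ⋃ ℓ, transBox ℓ, ‖F x‖) :=
    hasSum_integral_iUnion (fun ℓ => measurableSet_transBox ℓ) pairwise_disjoint_transBox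
      (by rw [iUnion_transBox]; exact hF.norm.integrableOn)
  refine Summable.of_nonneg_of_le (fun ℓ => norm_nonneg _) (fun ℓ => ?_) hn.summable
  rw [pi_Ico_eq_transBox_zero, ← setIntegral_transBox]
  exact norm_integral_le_integral_norm _

end PeriodicUnfolding

end Literature.Probability.LatticeModels
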